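import Mathlib
import Summits.ValiantsHypothesis.ValiantsHypothesis.Theorems.GrenetZeonTwoDimCoefficientsScalingBlockTriangularCoupling

/-!
# Crux `GrenetZeon.TwoDimCoefficients` (stmt-ValiantsHypothesis-8062) / rung `DualUnipotentThreeHalves` (stmt-24318):
# scaling-closure — THIRD-ORDER VANISHING AT THE PRICING POINT IS FREE (ledger plumbing)

The ledger inequality ✓ `sq_sub_rank_mul_le_of_levelCut` (p838815) prices every constituent of a representation
`per_n = tr(N^{n−1}M)` by the rank of its Hessian at ONE point (a permutation point `P_τ`).  That rank only sees the 2-jet: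
derivations lower ideal powers by one (`pderiv_mem_pow_of_mem_pow_succ`, any ideal), so a constituent lying in the CUBE of an
ideal of polynomials vanishing at the pricing point has Hessian `0` there (`hess0_transl_eq_zero_of_mem_pow_three`).  At `P_τ` the
relevant ideal is generated by the OFF-`τ` variables `X_c`, `c.1 ≠ τ c.2` (`hess0_transl_permPoint_eq_zero_of_mem_offPerm_pow_three`):
every constituent each of whose terms carries at least three off-`τ` variables — e.g. a class whose pencil AND numerator involve only
off-`τ` variables (`n ≥ 3`), or any trace word with three off-`τ` blocks — is FREE in the ledger, however many variables it involves
(the support price ✓ `rank_hess0_transl_le_of_pderiv_pderiv_eq_zero` would charge `2|S|`).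

* `pderiv_mem_pow_of_mem_pow_succ` — `g ∈ I^{k+1} ⟹ ∂_s g ∈ I^k` for every ideal `I` of a polynomial ring;
* `hess0_transl_eq_zero_of_mem_pow_three` — `I ≤ ker(eval z)`, `g ∈ I³ ⟹ Hess g(z) = 0`;
* ★ `hess0_transl_permPoint_eq_zero_of_mem_offPerm_pow_three` — the permutation-point instance.

HONEST FRAMING: plumbing (the 2-jet principle made citable); proves no rung: `DualUnipotentBound`, crux 8062, the 24318 decl and
`VP ≠ VNP` remain open.

References: folklore.
-/

-- single-conjunct layout `Summits/ValiantsHypothesis/ValiantsHypothesis`: the duplicated namespace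
-- component is mandated by the tree.
set_option linter.dupNamespace false
set_option autoImplicit false

noncomputable section

namespace Summit.ValiantsHypothesis.ValiantsHypothesis.Theorems.GrenetZeonTwoDimCoefficients.ScalingClosure

open MvPolynomial Matrix
open Literature.Computability.AlgebraicComplexity

section ThirdOrderFree

variable {σ : Type*}

/-- **Derivations lower ideal powers by one**: `g ∈ I^{k+1} ⟹ ∂_s g ∈ I^k`, for every ideal `I` of `ℂ[X_σ]`. [folklore] -/
theorem pderiv_mem_pow_of_mem_pow_succ (I : Ideal (MvPolynomial σ ℂ)) (s : σ) :
    ∀ (k : ℕ) (g : MvPolynomial σ ℂ), g ∈ I ^ (k + 1) → pderiv s g ∈ I ^ k := by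
  intro k
  induction k with
  | zero => intro g _; rw [pow_zero, Ideal.one_eq_top]; exact Submodule.mem_top
  | succ k ih =>
    intro g hg
    rw [pow_succ'] at hg
    refine Submodule.mul_induction_on hg (fun a ha b hb => ?_) (fun x y hx hy => ?_)
    · rw [pderiv_mul]
      refine Ideal.add_mem _ ?_ ?_
      · exact Ideal.mul_mem_left _ _ hb
      · rw [pow_succ']
        exact Ideal.mul_mem_mul ha (ih b hb)
    · rw [map_add]
      exact Ideal.add_mem _ hx hy

/-- **Third-order vanishing at the pricing point is free.**  If every element of the ideal `I` vanishes at `z` and `g ∈ I³`,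
then `Hess g(z) = 0`. [folklore] -/
theorem hess0_transl_eq_zero_of_mem_pow_three [Fintype σ] [DecidableEq σ] (I : Ideal (MvPolynomial σ ℂ)) (z : σ → ℂ)
    (hI : ∀ f ∈ I, eval z f = 0) (g : MvPolynomial σ ℂ) (hg : g ∈ I ^ 3) :
    hess0 (transl z g) = 0 := by
  ext s t
  rw [hess0_transl, Matrix.zero_apply]
  have h2 : pderiv t g ∈ I ^ 2 := pderiv_mem_pow_of_mem_pow_succ I t 2 g hg
  have h1 : pderiv s (pderiv t g) ∈ I ^ 1 := pderiv_mem_pow_of_mem_pow_succ I s 1 _ h2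
  rw [pow_one] at h1
  exact hI _ h1

variable {n : ℕ}

/-- ★ **Off-permutation cubic constituents are free at the permutation point.**  Let `I_τ` be the ideal generated by the
off-`τ` variables `X_c` (`c.1 ≠ τ c.2`).  If `g ∈ I_τ³` then `Hess g (P_τ) = 0`: in the ledger at `P_τ` such a constituent costs
nothing. [folklore] -/
theorem hess0_transl_permPoint_eq_zero_of_mem_offPerm_pow_three (τ : Equiv.Perm (Fin n)) (g : MvPolynomial (Fin n × Fin n) ℂ)
    (hg : g ∈ Ideal.span ((fun c : Fin n × Fin n => (X c : MvPolynomial (Fin n × Fin n) ℂ)) '' {c | c.1 ≠ τ c.2}) ^ 3) :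
    hess0 (transl (fun u : Fin n × Fin n => if u.1 = τ u.2 then (1 : ℂ) else 0) g) = 0 := by
  refine hess0_transl_eq_zero_of_mem_pow_three _ _ (fun f hf => ?_) g hg
  have hle : Ideal.span ((fun c : Fin n × Fin n => (X c : MvPolynomial (Fin n × Fin n) ℂ)) '' {c | c.1 ≠ τ c.2}) ≤
      RingHom.ker (eval (fun u : Fin n × Fin n => if u.1 = τ u.2 then (1 : ℂ) else 0)) := by
    rw [Ideal.span_le]
    rintro _ ⟨c, hc, rfl⟩
    rw [SetLike.mem_coe, RingHom.mem_ker, MvPolynomial.eval_X, if_neg hc]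
  exact hle hf

/-- **A trace word with entries in an ideal.**  If every entry of each of the matrices `P_1, …, P_L` (a list) lies in `I`, then
every entry of their product lies in `I^L`; hence a trace of a product with at least three factors whose entries are off-`τ`
linear forms is free at `P_τ`.  Entrywise form for a product of two matrices: [folklore] -/
theorem mul_apply_mem_mul {m : ℕ} (I J : Ideal (MvPolynomial σ ℂ)) (P Q : Matrix (Fin m) (Fin m) (MvPolynomial σ ℂ))
    (hP : ∀ i j, P i j ∈ I) (hQ : ∀ i j, Q i j ∈ J) (i j : Fin m) : (P * Q) i j ∈ I * J := by
  rw [Matrix.mul_apply]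
  exact Ideal.sum_mem _ fun l _ => Ideal.mul_mem_mul (hP i l) (hQ l j)

/-- Entries of powers: `P i j ∈ I` for all `i, j` ⟹ `(P^k) i j ∈ I^k`. [folklore] -/
theorem pow_apply_mem_pow {m : ℕ} (I : Ideal (MvPolynomial σ ℂ)) (P : Matrix (Fin m) (Fin m) (MvPolynomial σ ℂ))
    (hP : ∀ i j, P i j ∈ I) : ∀ (k : ℕ) (i j : Fin m), (P ^ k) i j ∈ I ^ k := by
  intro k
  induction k with
  | zero => intro i j; rw [pow_zero, Ideal.one_eq_top]; exact Submodule.mem_top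
  | succ k ih =>
    intro i j
    rw [pow_succ, pow_succ]
    exact mul_apply_mem_mul _ _ _ _ ih hP i j

/-- The trace of a matrix with entries in `I` lies in `I`. [folklore] -/
theorem trace_mem {m : ℕ} (I : Ideal (MvPolynomial σ ℂ)) (P : Matrix (Fin m) (Fin m) (MvPolynomial σ ℂ))
    (hP : ∀ i j, P i j ∈ I) : P.trace ∈ I :=
  Ideal.sum_mem _ fun i _ => hP i i

/-- ★ **Classes living off the permutation are free.**  If all entries of the pencil `N` lie in the off-`τ` ideal `I_τ` and
`k + 1 ≥ 3` (or the numerator supplies the missing factors), then `tr(N^k·M) ∈ I_τ^{k}·(M) ⊆ I_τ³` and its Hessian at `P_τ`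
vanishes.  Stated for `N` with entries in `I_τ`, `M` arbitrary, `k ≥ 3`. [folklore] -/
theorem hess0_transl_permPoint_trace_pow_mul_eq_zero {m : ℕ} (τ : Equiv.Perm (Fin n))
    (N M : Matrix (Fin m) (Fin m) (MvPolynomial (Fin n × Fin n) ℂ))
    (hN : ∀ i j, N i j ∈ Ideal.span ((fun c : Fin n × Fin n => (X c : MvPolynomial (Fin n × Fin n) ℂ)) '' {c | c.1 ≠ τ c.2}))
    (k : ℕ) (hk : 3 ≤ k) :
    hess0 (transl (fun u : Fin n × Fin n => if u.1 = τ u.2 then (1 : ℂ) else 0) ((N ^ k * M).trace)) = 0 := by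
  set I := Ideal.span ((fun c : Fin n × Fin n => (X c : MvPolynomial (Fin n × Fin n) ℂ)) '' {c | c.1 ≠ τ c.2}) with hI
  refine hess0_transl_permPoint_eq_zero_of_mem_offPerm_pow_three τ _ ?_
  have hNk : ∀ i j, (N ^ k) i j ∈ I ^ k := pow_apply_mem_pow I N hN k
  have hentry : ∀ i j, (N ^ k * M) i j ∈ I ^ k := by
    intro i j
    rw [Matrix.mul_apply]
    exact Ideal.sum_mem _ fun l _ => Ideal.mul_mem_right _ _ (hNk i l)
  exact Ideal.pow_le_pow_right hk (trace_mem _ _ hentry)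

end ThirdOrderFree

section PricingPoint

open Summit.ValiantsHypothesis.ValiantsHypothesis.Cruxes.TwoDimCoefficients.DimTwoCases
open Summit.ValiantsHypothesis.ValiantsHypothesis.Theorems.GrenetZeon.SlowCore

variable {n m : ℕ}

/-- ★ **The ledger inequality at an ARBITRARY pricing point.**  Normal form `per_n = tr(N^{n−1}M)` (`N, M` linear), `N`
level-cut for `lvl`, `good` a set of levels whose class pencils have nil-index `≤ n`, and ANY point `z`:
`(rank Hess per_n(z) − rank Hess rest(z))·n ≤ 2·Σ_{p ∈ good} s_p²`, `rest = Σ_{p ∉ good} tr((N|_p)^{n−1}·M|_p) + tr(N^{n−1}·M^cut)`.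
(At a permutation point `rank Hess per_n = n²`: ✓ `sq_sub_rank_mul_le_of_levelCut`; the freedom in `z` is what the point-dependent
prices — support, third-order vanishing — are chosen against.) [cite: MignonRessayre2004, Thm. 1.1 — via the tree; folklore] -/
theorem rank_sub_rank_mul_le_of_levelCut (hn : 2 ≤ n) (N M : AffMat n m)
    (hN : ∀ i j, (N i j).IsHomogeneous 1) (hM : ∀ i j, (M i j).IsHomogeneous 1)
    (hper : perPoly (Fin n) ℂ = (N ^ (n - 1) * M).trace)
    (lvl : Fin m → ℕ) (hcut : ∀ a b, lvl a < lvl b → N a b = 0)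
    (s : ℕ → ℕ) (e : ∀ p : ℕ, {i : Fin m // lvl i = p} ≃ Fin (s p))
    (good : Finset ℕ) (hgoodsub : good ⊆ Finset.univ.image lvl)
    (hgood : ∀ p ∈ good, (classPencil N (e p)) ^ n = 0) (z : Fin n × Fin n → ℂ) :
    ((hess0 (transl z (perPoly (Fin n) ℂ))).rank -
      (hess0 (transl z
        ((∑ p ∈ (Finset.univ.image lvl).filter (fun p => p ∉ good),
            ((classPencil N (e p)) ^ (n - 1) * classPencil M (e p)).trace) +
          (N ^ (n - 1) * Matrix.of (fun i j : Fin m => if lvl i < lvl j then M i j else 0)).trace))).rank) * n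
      ≤ 2 * ∑ p ∈ good, s p ^ 2 := by
  classical
  set cutTerm : MvPolynomial (Fin n × Fin n) ℂ :=
    (N ^ (n - 1) * Matrix.of (fun i j : Fin m => if lvl i < lvl j then M i j else 0)).trace with hcutTerm
  have hsplit := trace_pow_mul_eq_sum_classPencil_add_cut lvl N M hcut s e (n - 1)
  set levels := Finset.univ.image lvl with hlev
  set gW : MvPolynomial (Fin n × Fin n) ℂ :=
    ∑ p ∈ levels.filter (fun p => p ∉ good), ((classPencil N (e p)) ^ (n - 1) * classPencil M (e p)).trace with hgW
  have hgood_eq : levels.filter (fun p => p ∈ good) = good := by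
    ext p
    rw [Finset.mem_filter]
    exact ⟨fun h => h.2, fun h => ⟨hgoodsub h, h⟩⟩
  have hper' : perPoly (Fin n) ℂ =
      (∑ p ∈ good, ((classPencil N (e p)) ^ (n - 1) * classPencil M (e p)).trace) + (gW + cutTerm) := by
    rw [hper, hsplit, ← hgood_eq, hgW, ← add_assoc]
    congr 1
    exact (Finset.sum_filter_add_sum_filter_not levels (fun p => p ∈ good) _).symm
  -- re-index the good classes by `Fin r`
  set r := good.card with hr
  set enum : Fin r → ℕ := fun i => (good.equivFin.symm i : ℕ) with henum
  have henum_mem : ∀ i, enum i ∈ good := fun i => (good.equivFin.symm i).2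
  have hsum_enum : ∀ f : ℕ → MvPolynomial (Fin n × Fin n) ℂ, ∑ p ∈ good, f p = ∑ i : Fin r, f (enum i) := by
    intro f
    rw [← Finset.sum_coe_sort good]
    exact (Fintype.sum_equiv good.equivFin.symm (fun i => f (enum i)) (fun x => f x) (fun i => rfl)).symm
  have hsum_enum_nat : ∑ p ∈ good, s p ^ 2 = ∑ i : Fin r, s (enum i) ^ 2 := by
    rw [← Finset.sum_coe_sort good]
    exact (Fintype.sum_equiv good.equivFin.symm (fun i => s (enum i) ^ 2) (fun x => s x ^ 2) (fun i => rfl)).symm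
  rw [hsum_enum_nat]
  exact rank_sub_mul_le_of_tracePowParts_add_rankPart hn (fun i => s (enum i))
    (fun i => classPencil N (e (enum i))) (fun i => classPencil M (e (enum i))) (fun _ => 1)
    (fun i a b => hN _ _) (fun i a b => hM _ _) (fun i => hgood _ (henum_mem i))
    (fun i => pow_card_eq_zero_of_pow_eq_zero _ (hgood _ (henum_mem i))) (gW + cutTerm) z
    (by rw [hper', hsum_enum]; simp only [map_one, one_mul])

end PricingPoint

end Summit.ValiantsHypothesis.ValiantsHypothesis.Theorems.GrenetZeonTwoDimCoefficients.ScalingClosure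

end
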